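import Mathlib
import HarnessLib
import Summits.ResolutionOfSingularities.ResolutionOfSingularities.Theorems.WildQuotientsWildQuotientResolutionPthConeDefs
import Summits.ResolutionOfSingularities.ResolutionOfSingularities.Theorems.WildQuotientsWildQuotientResolutionQuotientModelProperBirational
import Literature.AlgebraicGeometry.Resolution.ResolutionOfSingularities
import Literature.AlgebraicGeometry.Resolution.LogRegularSchemeEtale

/-!
# S1 KILL-or-EXIT definitions (D2 of the S1a skeleton cut, crux `CyclicQuotientFourfolds`) — v1 (LOG form)

Crux stmt-ResolutionOfSingularities-17941 (`WildQuotients.CyclicQuotientFourfolds`), S1a skeleton line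
`s1a-logminvertex` (plan-1 `S1A-CUT.md`; director RULING w45c-S1a-RESIDUAL; plan-1 RULING D2 v1 OF RECORD
2026-08-27T18:13:15Z folding idea-2 g14 REVIEW Δ1–Δ5 + (P6), tri-1 (V1)–(V3), tri-2 (E1)–(E3)/(R-B)).
DEFINITION LANE ONLY — no theorems. [OURS · L1 W4.5c] — NOT statements of the manuscript; counted 0 post-V5.

THE OUTPUT SHAPE of the S1 theory (the adapted log-min-vertex game) for an order-`p` action `G ↷ X′` on a
regular integral `X′` with quotient `q : X′ → X₁`: a `G`-equivariant proper birational integral model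
`π : V → X′`, ROOT-REGULAR UPSTAIRS (`LocallyDiagonalRootRegular V`: every point of `V` has an affine
neighbourhood whose ring is the weight-zero part of a REGULAR Noetherian ring graded by a finite product of
`ZMod (r j)` — the root charts of weighted blow-ups; `m = 0` = a regular chart), covered by `G`-stable affine
opens affine over `X₁` (so the quotient `V/G = ρB.glued` exists, `Literature/…/FiniteGroupQuotientGluing`, and
maps properly birationally onto `X₁`, `QuotientModel…ProperBirational`), whose quotient `Y := V/G` is REGULAR off a
closed set `Z` (KILL: Király–Lütkebohmert points and untouched regular points) and carries, on an OPEN ZONE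
`W ⊇ Z`, a LOG REGULAR STRUCTURE WITH ÉTALE fs CHARTS (EXIT: `Scheme.IsLogRegularEtale ↑W`, Nizioł 2006
Def. 2.2 / Kato 1994 (2.1) on `W_ét`). The log structure is LOCAL NEAR THE NON-REGULAR LOCUS, not global: a
global atlas would force the boundary to be normal crossings at every KILL point it passes (spurious — wild
images `E/G` of stable divisors can be non-normal at regular quotient points). What the log typing asks of the
producer (idea-2 Δ3, étale version): on `W`, ONE étale log structure whose germ at each point of `Z` is a toric
boundary of the (étale-locally toric) singularity there — coordinated along positive-dimensional components of
`Z` (exit curves exist: J₄, p = 5, 7), normal crossings at the regular points of `W` (automatic near `Z` for a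
toric boundary; shrink `W`). No splitting condition over residue fields is owed (étale charts).

THE CONSUMER BRICK is a named statement `LogExitPatching` (Nizioł 2006 Thm 5.10, STRONG form: the canonical
log blow-up of `W` is a resolution and an isomorphism over `W_reg ⊇ W ∖ Z`; glued with `Y ∖ Z`) — true in
print; the tree holds the weak forms `Niziol2006_logRegularScheme_hasResolution_holds` /
`Kato1994_logRegular_hasResolution_general_holds` (PROVED), from which the strong form is a Literature extension.

UPSTAIRS PIN (anti-costume): without a pin on `V`, the normalisation `V := Nor_{k(X′)}(Y)` of a resolution
`Y → X₁` would inhabit the model from the summit statement alone; `LocallyDiagonalRootRegular V` excludes it (no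
one can certify root-regularity of a wild normalisation) while being TRUE of the game's weighted towers
(V4U `Bl_{I₆}𝔸⁴`, V5/ℤ9 `Bl_{I₂₈}𝔸⁴` root charts; card P `w*`; MON `(6,3,2,0)`); `Scheme.IsRegular V` (v0–v0.3)
is NOT used because it is false for those towers (cyclic-quotient / `μ_p` vertices upstairs).

* `S1.IsDiagonalRootChart A`, `S1.LocallyDiagonalRootRegular V` — the pin (idea-2 g14 (P6), verbatim).
* `S1.LogExitZone Y` — `∃ W Z`, `Z` closed `⊆ W` open, `W` quasi-compact, `Y` regular off `Z`, `↑W` étale log regular.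
* `S1.LogExitPatching` — the consumer brick: integral quasi-compact `Y` with a log exit zone has a resolution.
* `S1.KillOrExitModel q G ρ` — existence of the pinned equivariant model with `LogExitZone (V/G)`.
* `S1.GlobalKillOrExit p` — the model exists for every datum of `CyclicQuotientFourfolds` at the prime `p` with
  faithful action (binders verbatim from `Theses/WildQuotients.lean`; `ρ = 1` is handled in the assembly).
* `S1.LocalKillOrExit p n` — the same for ONE complete local model `Spec κ[[x₁,…,x_n]]`, `κ` perfect of
  characteristic `p`, `σ` a `κ`-algebra automorphism of order `p` (G2 vocabulary).
* `S1.CyclicQuotientAt p` — the crux statement at one prime (`CyclicQuotientFourfolds ↔ ∀ p prime, …` by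
  `Iff.rfl`), the conclusion type of the assembly stub.

Dead typings (record): Zariski cone EXIT charts (v0/v0.2) are unsatisfiable intrinsically (local form: a
localisation of a finitely generated algebra over a field is Jacobson, the quotient charts of a complete local
model are not; global form: a ring iso with a cone algebra forces `X₁` `k`-rational — false for `X′ = E × 𝔸³`);
pointwise formal-cone germs (v0.3) leave the gluing of local cone resolutions along exit curves to a brick with no
boundary datum — superseded by the log form, whose brick is a theorem.
-/

-- single-problem summit: the doubled namespace component `ResolutionOfSingularities` is forced
set_option linter.dupNamespace false

noncomputable section

open CategoryTheory AlgebraicGeometry TopologicalSpace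
open Literature.AlgebraicGeometry.Resolution Literature.AlgebraicGeometry.RelativeSpec

namespace Summit.ResolutionOfSingularities.ResolutionOfSingularities.Theorems.WildQuotientResolution.S1

universe u

/-- **Diagonal root chart** of a ring `A`: `A` is ring-isomorphic to the degree-`0` part of a REGULAR
Noetherian commutative ring `B` graded by the finite product `Π j : Fin m, ZMod (r j)` (i.e. `A` is the ring of
invariants = the degree-`0` part of `B` under the diagonal action of the diagonalisable group scheme `Π_j D(ZMod (r j))`
— an affine invariant-ring presentation, no GIT-stability word intended (tri-1 18:24:33Z N2); `r j = char` is allowed —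
the `μ_p` charts; `r j = 0`, `ZMod 0 = ℤ`, is a torus weight and is allowed — the Rees charts of weighted blow-ups,
idea-2 18:15:49Z; `m = 0` says `A ≅ B` is regular). The affine charts `𝔸ⁿ ↷ μ_w` of a weighted blow-up and their iterates are diagonal root charts.
[OURS · L1 W4.5c] (idea-2 g14 (P6)) -/
def IsDiagonalRootChart (A : Type u) [CommRing A] : Prop :=
  ∃ (m : ℕ) (r : Fin m → ℕ) (B : Type u) (_ : CommRing B)
    (𝒜 : (Π j : Fin m, ZMod (r j)) → AddSubgroup B) (_ : GradedRing 𝒜),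
    IsNoetherianRing B ∧ IsRegularRing B ∧ Nonempty (A ≃+* ↥(𝒜 0))

/-- **(P6) Locally diagonal-root-regular** scheme: every point lies in an affine open whose coordinate ring is a
diagonal root chart. Satisfied by regular schemes covered by Noetherian affine opens (`m = 0`), by weighted
blow-ups of regular schemes in regular centres (root charts) and by their iterates along monomially adapted
towers; NOT visibly satisfied by the normalisation of a resolution of `X₁` in `k(X′)` — the anti-costume pin of
`KillOrExitModel`. [OURS · L1 W4.5c] (idea-2 g14 (P6)) -/
def LocallyDiagonalRootRegular (V : Scheme.{u}) : Prop :=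
  ∀ v : V, ∃ U : V.affineOpens, v ∈ (U : V.Opens) ∧ IsDiagonalRootChart Γ(V, (U : V.Opens))

/-- **Log exit zone** of a scheme `Y` (KILL-or-EXIT, local log form): an open `W ⊆ Y` and a closed set `Z ⊆ W`
such that `W` is quasi-compact, every point of `Y` outside `Z` has a REGULAR local ring (KILL points and untouched
regular points), and the open subscheme `↑W` underlies a LOG REGULAR scheme with fs ÉTALE charts
(`Scheme.IsLogRegularEtale`, Nizioł 2006 Def. 2.2) — the EXIT zone. `W = ⊥, Z = ∅` is the all-KILL case
(`Y` regular); the log structure is only required near the non-regular locus. [OURS · L1 W4.5c] -/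
def LogExitZone (Y : Scheme.{0}) : Prop :=
  ∃ (W : Y.Opens) (Z : Set Y), IsClosed Z ∧ Z ⊆ (W : Set Y) ∧ CompactSpace (W : Scheme.{0}) ∧
    (∀ y : Y, y ∉ Z → IsRegularLocalRing (Y.presheaf.stalk y)) ∧
    Literature.AlgebraicGeometry.Resolution.Scheme.IsLogRegularEtale (W : Scheme.{0})

/-- **Log exit patching** (the consumer brick of the S1a skeleton; Nizioł 2006 Thm 5.10 in the STRONG form «the
canonical log blow-up of a log regular `W` is a resolution and an isomorphism over the regular locus of `W`», glued
with the identity of `Y ∖ Z` along `W ∖ Z`): an integral quasi-compact scheme with a log exit zone has a resolution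
of singularities. True in print; the tree's `Niziol2006_logRegularScheme_hasResolution_holds` /
`Kato1994_logRegular_hasResolution_general_holds` are the weak forms (no statement over the regular locus).
`p`-free and dimension-free. [OURS · L1 W4.5c] (ingredient in print: Nizioł 2006, Thm 5.10 and Cor. 5.7 —
cited in prose, since this OURS consumer statement is not the printed one) -/
def LogExitPatching : Prop :=
  ∀ (Y : Scheme.{0}) [IsIntegral Y] [CompactSpace Y], LogExitZone Y →
    Literature.AlgebraicGeometry.Resolution.Scheme.HasResolution Y

/-- **KILL-or-EXIT model** for an action datum `(q : X′ → X₁, ρ : G → Aut X′)`: a `G`-equivariant proper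
birational integral ROOT-REGULAR model `π : V → X′`, separated over the separated `X₁`, every point of `V` in a
`G`-stable open affine over `X₁` (so the quotient `V/G = ρB.glued` of `Literature/…/FiniteGroupQuotientGluing` exists
and maps properly birationally onto `X₁`), whose quotient has a LOG EXIT ZONE. Pinned upstairs
(`LocallyDiagonalRootRegular V`), so neither the summit statement (via the normalisation of a resolution) nor
«`V := X′`» gives it cheaply. [OURS · L1 W4.5c] -/
def KillOrExitModel {X' X₁ : Scheme.{0}} (q : X' ⟶ X₁)
    (G : Type) [Group G] [Finite G] (ρ : G →* Aut X') : Prop :=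
  ∃ (V : Scheme.{0}) (π : V ⟶ X') (_ : X₁.IsSeparated) (_ : IsSeparated (π ≫ q))
    (ρB : ActionOver (π ≫ q) G),
    IsProper π ∧ IsBirational π ∧ IsIntegral V ∧ LocallyDiagonalRootRegular V ∧
    (∀ g : G, (ρB.aut g).hom ≫ π = π ≫ (ρ g).hom) ∧
    (∀ v : V, ∃ O : ρB.StableAffineOpens, v ∈ O.1) ∧
    LogExitZone ρB.glued

/-- **S1 output, GLOBAL form**: for every datum of `CyclicQuotientFourfolds` at the prime `p` with a FAITHFUL
action, a KILL-or-EXIT model exists (binders verbatim from `Theses/WildQuotients.lean`; the non-faithful case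
`ρ = 1` is handled in the assembly, where `q` itself is a resolution). [OURS · L1 W4.5c] -/
def GlobalKillOrExit (p : ℕ) : Prop :=
  ∀ (k : Type) [Field k] [CharP k p] [PerfectField k] (X' X₁ : AlgebraicGeometry.Scheme.{0})
    (f : X₁ ⟶ AlgebraicGeometry.Spec (.of k)) (q : X' ⟶ X₁) (G : Type) [Group G] [Finite G]
    (ρ : G →* CategoryTheory.Aut X'), Nat.card G = p → AlgebraicGeometry.IsSeparated f →
    AlgebraicGeometry.LocallyOfFiniteType f → AlgebraicGeometry.QuasiCompact f →
    AlgebraicGeometry.IsIntegral X₁ → AlgebraicGeometry.IsIntegral X' →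
    Literature.AlgebraicGeometry.Resolution.Scheme.IsRegular X' → AlgebraicGeometry.IsFinite q →
    Function.Surjective q.base →
    (∃ U : X₁.Opens, Dense (U : Set X₁) ∧ AlgebraicGeometry.Etale (AlgebraicGeometry.morphismRestrict q U)) →
    (∀ g : G, CategoryTheory.CategoryStruct.comp (ρ g).hom q = q) →
    (∀ x y : X', q.base x = q.base y → ∃ g : G, (ρ g).hom.base x = y) →
    topologicalKrullDim X₁ ≤ 4 → Function.Injective ρ →
    KillOrExitModel q G ρ

/-- **S1 output, COMPLETE LOCAL form** in dimension `n`: for `κ` perfect of characteristic `p` and a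
`κ`-algebra automorphism `σ` of order `p` of `κ[[x₁,…,x_n]]`, the datum `Spec κ[[x]] → Spec κ[[x]]^σ` with the
action of `⟨σ⟩` (spelled as in G2 `AffineQuotient.hasResolution_spec_fixedPoints_of_model`: `ρ g = Spec (g⁻¹)`)
admits a KILL-or-EXIT model. [OURS · L1 W4.5c] -/
def LocalKillOrExit (p n : ℕ) : Prop :=
  ∀ (κ : Type) [Field κ] [CharP κ p] [PerfectField κ]
    (σ : MvPowerSeries (Fin n) κ ≃ₐ[κ] MvPowerSeries (Fin n) κ) [Finite ↥(Subgroup.zpowers σ)],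
    σ ≠ 1 → σ ^ p = 1 →
    ∀ (ρ : ↥(Subgroup.zpowers σ) →* Aut (Spec (CommRingCat.of (MvPowerSeries (Fin n) κ)))),
      (∀ g : ↥(Subgroup.zpowers σ), (ρ g).hom = Spec.map (CommRingCat.ofHom
        ((MulSemiringAction.toRingEquiv (↥(Subgroup.zpowers σ)) (MvPowerSeries (Fin n) κ) g⁻¹ :
          MvPowerSeries (Fin n) κ ≃+* MvPowerSeries (Fin n) κ) : MvPowerSeries (Fin n) κ →+* MvPowerSeries (Fin n) κ))) →
      KillOrExitModel
        (Spec.map (CommRingCat.ofHom (algebraMap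
          (FixedPoints.subalgebra κ (MvPowerSeries (Fin n) κ) (Subgroup.zpowers σ)) (MvPowerSeries (Fin n) κ))))
        (↥(Subgroup.zpowers σ)) ρ

/-- **`CyclicQuotientFourfolds` at one prime `p`**: the body of the crux statement after `p.Prime →`
(binders verbatim), so that `CyclicQuotientFourfolds ↔ ∀ p, p.Prime → CyclicQuotientAt p` holds by `Iff.rfl`;
the conclusion type of the skeleton's assembly stub. [OURS · L1 W4.5c] -/
def CyclicQuotientAt (p : ℕ) : Prop :=
  ∀ (k : Type) [Field k] [CharP k p] [PerfectField k] (X' X₁ : AlgebraicGeometry.Scheme.{0})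
    (f : X₁ ⟶ AlgebraicGeometry.Spec (.of k)) (q : X' ⟶ X₁) (G : Type) [Group G] [Finite G]
    (ρ : G →* CategoryTheory.Aut X'), Nat.card G = p → AlgebraicGeometry.IsSeparated f →
    AlgebraicGeometry.LocallyOfFiniteType f → AlgebraicGeometry.QuasiCompact f →
    AlgebraicGeometry.IsIntegral X₁ → AlgebraicGeometry.IsIntegral X' →
    Literature.AlgebraicGeometry.Resolution.Scheme.IsRegular X' → AlgebraicGeometry.IsFinite q →
    Function.Surjective q.base →
    (∃ U : X₁.Opens, Dense (U : Set X₁) ∧ AlgebraicGeometry.Etale (AlgebraicGeometry.morphismRestrict q U)) →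
    (∀ g : G, CategoryTheory.CategoryStruct.comp (ρ g).hom q = q) →
    (∀ x y : X', q.base x = q.base y → ∃ g : G, (ρ g).hom.base x = y) →
    topologicalKrullDim X₁ ≤ 4 → Literature.AlgebraicGeometry.Resolution.Scheme.HasResolution X₁

end Summit.ResolutionOfSingularities.ResolutionOfSingularities.Theorems.WildQuotientResolution.S1

end
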